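import Literature.AlgebraicGeometry.Frobenioids.CdTransportObjects
import HarnessLib

/-!
# Frobenioids I, Proposition 2.5 (iii), bracket: `C(d) → F_{d·Φ}` is a Frobenioid — proof

Mochizuki, *The geometry of Frobenioids I: the general theory*, Kyushu J. Math. **62** (2008)
293–400, §2, Proposition 2.5 (iii), kurims text p. 49 [cite: MochizukiFrdI2008, Prop. 2.5(iii) p.49]:
"(b) `Ψ` is 1-compatible … with the Frobenius functor associated to `d` on `F_Φ` [which implies, in
particular, that `C(d)`, equipped with the natural functor `C(d) → F_{d·Φ}`, is a Frobenioid]."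

Every clause of Def. 1.3 for `C(d) → F_{d·Φ}` is obtained from the same clause for `C → F_Φ` by
transport along the unit-linear Frobenius functor `Ψ : C ⥲ C(d)` (identity on objects, bijective
on arrows, compatible with `Base`, `deg_Fr` and — through the isomorphism `d · (−) : Φ ⥲ d · Φ` —
with `Div`), using the dictionaries of `CdTransport.lean` and `CdTransportObjects.lean`
(`isFrobenioid_cd`).  Discharges the named statement `CdIsFrobenioid F d`
(`cdIsFrobenioid`, `Λ = ℤ`, `δ = powEnd Φ d`).

Provenance: typed/proved by abc-iut-L6-t9 (prover-abc-iut-L6-t9-g0-0; staged HOME/staging/L1/L6-t9/,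
MANIFEST.txt, session ended 2026-08-25T23:52Z inviting any seat to file verbatim); filed verbatim by
abc-iut-w5-d248 as filer-of-record (L1-lead ruling R82 (4), 2026-08-26T00:16:47Z) after re-verification
against the current tree (only change: fully-qualified closing types where applicable, and this note).
-/

noncomputable section

namespace Literature.AlgebraicGeometry.Frobenioids

open CategoryTheory Opposite

universe w v v' u u'

namespace PreFrobenioid

variable {D : Type u} [Category.{v} D] {Φ : Dᵒᵖ ⥤ CommMonCat.{w}}
  {C : Type u'} [Category.{v'} C] {F : C ⥤ ElemFrobenioid Φ}

namespace CharacteristicSplitting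

variable (hF : IsFrobenioid F) (τ : CharacteristicSplitting F) (hmt : IsOfType (IsMetricallyTrivial F))
  (haa : IsOfType (IsAutAmple F)) (δ : Φ ⟶ Φ) (hnorm : IsOfType (IsFrobeniusNormalized F))

set_option quotPrecheck false in
/-- The unit-linear Frobenius functor `Ψ : C → C(d)` as a functor (notation local to this file). -/
local notation "𝔊" => (unitLinearFrobeniusData hF τ hmt haa δ hnorm).functor

include hF τ hmt haa δ hnorm

/-- **`C(d) → F_{d·Φ}` is a Frobenioid** (for `δ` injective on each `Φ(A)`), by transport of every
clause of Def. 1.3 along `Ψ : C ⥲ C(d)`. [cite: MochizukiFrdI2008, Prop. 2.5(iii) p.49] -/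
theorem isFrobenioid_cd (hδ : ∀ A : Dᵒᵖ, Function.Injective (δ.app A).hom) :
    IsFrobenioid (cdToElem F δ) := by
  haveI := unitLinearFrobeniusData_isEquivalence hF τ hmt haa δ hnorm hδ
  -- the dictionary
  have hobj : ∀ X' : Cd F δ, ∃ X : C, (𝔊).obj X = X' := fun X' => ⟨X'.obj, rfl⟩
  have hb : ∀ {X Y : C} (γ : X ⟶ Y), Base (cdToElem F δ) ((𝔊).map γ) = Base F γ :=
    fun γ => base_cdFunctor_map hF τ hmt haa δ hnorm γ
  have hlin := fun {X Y : C} (γ : X ⟶ Y) => isLinear_cdFunctor_map_iff hF τ hmt haa δ hnorm γ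
  have hiso := fun {X Y : C} (γ : X ⟶ Y) => isIsometry_cdFunctor_map_iff hF τ hmt haa δ hnorm hδ γ
  have hpre := fun {X Y : C} (γ : X ⟶ Y) => isPreStep_cdFunctor_map_iff hF τ hmt haa δ hnorm γ
  have hco := fun {X Y : C} (γ : X ⟶ Y) => isCoAngular_cdFunctor_map_iff hF τ hmt haa δ hnorm hδ γ
  have hcps := fun {X Y : C} (γ : X ⟶ Y) =>
    isCoAngularPreStep_cdFunctor_map_iff hF τ hmt haa δ hnorm hδ γ
  have hft := fun {X Y : C} (γ : X ⟶ Y) => isFrobeniusType_cdFunctor_map_iff hF τ hmt haa δ hnorm hδ γ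
  have hpb := fun {X Y : C} (γ : X ⟶ Y) =>
    isPullbackMorphism_cdFunctor_map_iff hF τ hmt haa δ hnorm hδ γ
  have hii := fun {X Y : C} (γ : X ⟶ Y) => isIso_cdFunctor_map_iff hF τ hmt haa δ hnorm hδ γ
  exact {
    isPreFrobenioid := isPreFrobenioid_cd hF τ hmt haa δ hnorm hδ
    i_a := fun A₀ => by
      obtain ⟨A, hA, ⟨i⟩⟩ := hF.i_a A₀
      exact ⟨(𝔊).obj A, isFrobeniusTrivial_cdFunctor_obj hF τ hmt haa δ hnorm hδ hA, ⟨i⟩⟩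
    i_b := fun A' B' α => by
      obtain ⟨A, rfl⟩ := hobj A'
      obtain ⟨B, rfl⟩ := hobj B'
      obtain ⟨X, φ, ψ, hφ, hψ, h⟩ := hF.i_b A B α
      exact ⟨(𝔊).obj X, (𝔊).map φ, (𝔊).map ψ, (hpre φ).mpr hφ, (hpre ψ).mpr hψ,
        (congrArg (· ≫ α.hom) (hb φ)).trans (h.trans (hb ψ).symm)⟩
    i_c := fun A' => by
      obtain ⟨A, rfl⟩ := hobj A'
      haveI := pullbackSliceToBase_faithful (cdToElem F δ) ((𝔊).obj A)
      haveI := pullbackSliceToBase_full (cdToElem F δ) ((𝔊).obj A)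
      haveI : (pullbackSliceToBase (cdToElem F δ) ((𝔊).obj A)).EssSurj := by
        refine ⟨fun Y => ?_⟩
        obtain ⟨W, ψ, i, hψ, hψb⟩ := exists_isPullbackMorphism_over hF A Y.hom
        exact ⟨Over.mk (⟨(𝔊).map ψ, (hpb ψ).mpr hψ⟩ :
            (⟨(𝔊).obj W⟩ : PullbackCat (cdToElem F δ)) ⟶ ⟨(𝔊).obj A⟩),
          ⟨Over.isoMk i ((hb ψ).trans hψb).symm⟩⟩
      exact {}
    ii_exists := fun A' n => by
      obtain ⟨A, rfl⟩ := hobj A'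
      obtain ⟨B, φ, hφ, hd⟩ := hF.ii_exists A n
      exact ⟨(𝔊).obj B, (𝔊).map φ, (hft φ).mpr hφ,
        (degFr_cdFunctor_map hF τ hmt haa δ hnorm φ).trans hd⟩
    ii_unique := fun A' B' B'' φ' ψ' hφ hψ hd => by
      obtain ⟨A, rfl⟩ := hobj A'
      obtain ⟨B, rfl⟩ := hobj B'
      obtain ⟨B₂, rfl⟩ := hobj B''
      obtain ⟨φ, rfl⟩ := (𝔊).map_surjective φ'
      obtain ⟨ψ, rfl⟩ := (𝔊).map_surjective ψ'
      have hd' : degFr F φ = degFr F ψ := by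
        rw [← degFr_cdFunctor_map hF τ hmt haa δ hnorm φ, hd, degFr_cdFunctor_map]
      obtain ⟨β, hβ⟩ := hF.ii_unique φ ψ ((hft φ).mp hφ) ((hft ψ).mp hψ) hd'
      exact ⟨(𝔊).mapIso β, by rw [Functor.mapIso_hom, ← Functor.map_comp, hβ]⟩
    iii_a := fun X' Y' Z' f' g' hf hg => by
      obtain ⟨X, rfl⟩ := hobj X'
      obtain ⟨Y, rfl⟩ := hobj Y'
      obtain ⟨Z, rfl⟩ := hobj Z'
      obtain ⟨f, rfl⟩ := (𝔊).map_surjective f'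
      obtain ⟨g, rfl⟩ := (𝔊).map_surjective g'
      rw [← Functor.map_comp]
      exact (hco _).mpr (hF.iii_a f g ((hco f).mp hf) ((hco g).mp hg))
    iii_b := fun A' B' φ' hφ ψ' => by
      obtain ⟨A, rfl⟩ := hobj A'
      obtain ⟨B, rfl⟩ := hobj B'
      obtain ⟨φ, rfl⟩ := (𝔊).map_surjective φ'
      obtain ⟨ψ, rfl⟩ := (𝔊).map_surjective ψ'
      exact (hco ψ).mpr (hF.iii_b φ ((hcps φ).mp hφ) ψ)
    iii_c := fun A' B' φ' hφ => by
      obtain ⟨A, rfl⟩ := hobj A'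
      obtain ⟨B, rfl⟩ := hobj B'
      obtain ⟨φ, rfl⟩ := (𝔊).map_surjective φ'
      obtain ⟨e, he⟩ := hF.iii_c φ ((hcps φ).mp hφ)
      let EA := endSubmonoidCdEquiv hF τ hmt haa δ hnorm hδ A
      let EB := endSubmonoidCdEquiv hF τ hmt haa δ hnorm hδ B
      refine ⟨EA.symm.trans (e.trans EB), fun α => ?_⟩
      have h1 := he (EA.symm α)
      have h2 := map_endSubmonoidCdEquiv_symm_coe hF τ hmt haa δ hnorm hδ α
      show (𝔊).map φ ≫ (𝔊).map (e (EA.symm α)).1 = α.1 ≫ (𝔊).map φ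
      rw [← h2, ← Functor.map_comp, ← Functor.map_comp]
      exact congrArg (𝔊).map h1
    iii_c_base := fun A' B' φ' φ'' hφ hφ' hbb α β β' h h' => by
      obtain ⟨A, rfl⟩ := hobj A'
      obtain ⟨B, rfl⟩ := hobj B'
      obtain ⟨φ, rfl⟩ := (𝔊).map_surjective φ'
      obtain ⟨φ₂, rfl⟩ := (𝔊).map_surjective φ''
      let EA := endSubmonoidCdEquiv hF τ hmt haa δ hnorm hδ A
      let EB := endSubmonoidCdEquiv hF τ hmt haa δ hnorm hδ B
      have hαc := map_endSubmonoidCdEquiv_symm_coe hF τ hmt haa δ hnorm hδ α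
      have hβc := map_endSubmonoidCdEquiv_symm_coe hF τ hmt haa δ hnorm hδ β
      have hβ'c := map_endSubmonoidCdEquiv_symm_coe hF τ hmt haa δ hnorm hδ β'
      have key : EB.symm β = EB.symm β' := by
        refine hF.iii_c_base φ φ₂ ((hcps φ).mp hφ) ((hcps φ₂).mp hφ')
          ((hb φ).symm.trans (hbb.trans (hb φ₂))) (EA.symm α) _ _ ?_ ?_
        · apply (𝔊).map_injective
          rw [Functor.map_comp, Functor.map_comp, hαc, hβc]
          exact h
        · apply (𝔊).map_injective
          rw [Functor.map_comp, Functor.map_comp, hαc, hβ'c]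
          exact h'
      exact EB.symm.injective key
    iii_d_under_full := fun A' B' B'' φ' φ'' hφ hφ' hdvd => by
      obtain ⟨A, rfl⟩ := hobj A'
      obtain ⟨B, rfl⟩ := hobj B'
      obtain ⟨B₂, rfl⟩ := hobj B''
      obtain ⟨φ, rfl⟩ := (𝔊).map_surjective φ'
      obtain ⟨φ₂, rfl⟩ := (𝔊).map_surjective φ''
      obtain ⟨f, hf, hfφ⟩ := hF.iii_d_under_full φ φ₂ ((hcps φ).mp hφ) ((hcps φ₂).mp hφ')
        ((div_cdFunctor_map_dvd_iff hF τ hmt haa δ hnorm hδ φ φ₂).mp hdvd)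
      exact ⟨(𝔊).map f, (hcps f).mpr hf, by rw [← Functor.map_comp, hfφ]⟩
    iii_d_under_surj := fun A' x' => by
      obtain ⟨A, rfl⟩ := hobj A'
      obtain ⟨B, φ, hφ, hx⟩ := hF.iii_d_under_surj A ((imageEquiv δ hδ _).symm x')
      refine ⟨(𝔊).obj B, (𝔊).map φ, (hcps φ).mpr hφ, ?_⟩
      rw [div_cdFunctor_map hF τ hmt haa δ hnorm hδ, hx]
      exact (imageEquiv δ hδ _).apply_symm_apply x'
    iii_d_over_full := fun A' B' B'' ψ' ψ'' h h' hdvd => by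
      obtain ⟨A, rfl⟩ := hobj A'
      obtain ⟨B, rfl⟩ := hobj B'
      obtain ⟨B₂, rfl⟩ := hobj B''
      obtain ⟨ψ, rfl⟩ := (𝔊).map_surjective ψ'
      obtain ⟨ψ₂, rfl⟩ := (𝔊).map_surjective ψ''
      have hψ := (hcps ψ).mp h
      have hψ₂ := (hcps ψ₂).mp h'
      obtain ⟨g, hg, hgψ⟩ := hF.iii_d_over_full ψ ψ₂ hψ hψ₂
        ((invDiv_cdFunctor_map_dvd_iff hF τ hmt haa δ hnorm hδ ψ ψ₂ hψ.2.2 hψ₂.2.2 h.2.2 h'.2.2).mp hdvd)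
      exact ⟨(𝔊).map g, (hcps g).mpr hg, by rw [← Functor.map_comp, hgψ]⟩
    iii_d_over_surj := fun A' x' => by
      obtain ⟨A, rfl⟩ := hobj A'
      obtain ⟨B, ψ, hψ, hx⟩ := hF.iii_d_over_surj A ((imageEquiv δ hδ _).symm x')
      refine ⟨(𝔊).obj B, (𝔊).map ψ, (hcps ψ).mpr hψ, ?_⟩
      rw [invDiv_cdFunctor_map hF τ hmt haa δ hnorm hδ ψ hψ.2.2, hx]
      exact (imageEquiv δ hδ _).apply_symm_apply x'
    iv_a_exists := fun A' B' φ' => by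
      obtain ⟨A, rfl⟩ := hobj A'
      obtain ⟨B, rfl⟩ := hobj B'
      obtain ⟨φ, rfl⟩ := (𝔊).map_surjective φ'
      obtain ⟨X, Y, γ, β, α, hfac, hγ, hβ, hα⟩ := hF.iv_a_exists φ
      exact ⟨(𝔊).obj X, (𝔊).obj Y, (𝔊).map γ, (𝔊).map β, (𝔊).map α,
        by rw [← Functor.map_comp, ← Functor.map_comp, hfac],
        (hft γ).mpr hγ, (hpre β).mpr hβ, (hpb α).mpr hα⟩
    iv_a_unique := fun A' B' X' Y' X'' Y'' φ' γ' β' α' γ'' β'' α'' h1 hγ hβ hα h2 hγ' hβ' hα' => by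
      obtain ⟨A, rfl⟩ := hobj A'
      obtain ⟨B, rfl⟩ := hobj B'
      obtain ⟨X, rfl⟩ := hobj X'
      obtain ⟨Y, rfl⟩ := hobj Y'
      obtain ⟨X₂, rfl⟩ := hobj X''
      obtain ⟨Y₂, rfl⟩ := hobj Y''
      obtain ⟨φ, rfl⟩ := (𝔊).map_surjective φ'
      obtain ⟨γ, rfl⟩ := (𝔊).map_surjective γ'
      obtain ⟨β, rfl⟩ := (𝔊).map_surjective β'
      obtain ⟨α, rfl⟩ := (𝔊).map_surjective α'
      obtain ⟨γ₂, rfl⟩ := (𝔊).map_surjective γ''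
      obtain ⟨β₂, rfl⟩ := (𝔊).map_surjective β''
      obtain ⟨α₂, rfl⟩ := (𝔊).map_surjective α''
      have h1' : γ ≫ β ≫ α = φ :=
        (𝔊).map_injective (by rw [Functor.map_comp, Functor.map_comp]; exact h1)
      have h2' : γ₂ ≫ β₂ ≫ α₂ = φ :=
        (𝔊).map_injective (by rw [Functor.map_comp, Functor.map_comp]; exact h2)
      obtain ⟨ε, ζ, hε, hζ, hα''⟩ := hF.iv_a_unique φ γ β α γ₂ β₂ α₂ h1' ((hft γ).mp hγ)
        ((hpre β).mp hβ) ((hpb α).mp hα) h2' ((hft γ₂).mp hγ') ((hpre β₂).mp hβ') ((hpb α₂).mp hα')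
      refine ⟨(𝔊).mapIso ε, (𝔊).mapIso ζ, ?_, ?_, ?_⟩
      · rw [Functor.mapIso_hom, ← Functor.map_comp, hε]
      · rw [Functor.mapIso_hom, Functor.mapIso_hom, ← Functor.map_comp, ← Functor.map_comp, hζ]
      · rw [Functor.mapIso_hom, ← Functor.map_comp, hα'']
    iv_b := fun A' B' φ' hφ => by
      obtain ⟨A, rfl⟩ := hobj A'
      obtain ⟨B, rfl⟩ := hobj B'
      obtain ⟨φ, rfl⟩ := (𝔊).map_surjective φ'
      obtain ⟨⟨h1, h2⟩, h3⟩ := hF.iv_b φ ((hpb φ).mp hφ)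
      exact ⟨⟨(hco φ).mpr h1, (hiso φ).mpr h2⟩, (hlin φ).mpr h3⟩
    v_a := fun A' B' φ' hφ => by
      obtain ⟨A, rfl⟩ := hobj A'
      obtain ⟨B, rfl⟩ := hobj B'
      obtain ⟨φ, rfl⟩ := (𝔊).map_surjective φ'
      exact (mono_cdFunctor_map_iff hF τ hmt haa δ hnorm hδ φ).mpr (hF.v_a φ ((hpre φ).mp hφ))
    v_b_exists := fun A' B' φ' hφ => by
      obtain ⟨A, rfl⟩ := hobj A'
      obtain ⟨B, rfl⟩ := hobj B'
      obtain ⟨φ, rfl⟩ := (𝔊).map_surjective φ'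
      obtain ⟨X, β, α, hfac, hβ, hα⟩ := hF.v_b_exists φ ((hpre φ).mp hφ)
      exact ⟨(𝔊).obj X, (𝔊).map β, (𝔊).map α, by rw [← Functor.map_comp, hfac],
        (hcps β).mpr hβ, ⟨(hiso α).mpr hα.1, (hpre α).mpr hα.2⟩⟩
    v_b_unique := fun A' B' X' X'' φ' β' α' β'' α'' h1 hβ hα h2 hβ' hα' => by
      obtain ⟨A, rfl⟩ := hobj A'
      obtain ⟨B, rfl⟩ := hobj B'
      obtain ⟨X, rfl⟩ := hobj X'
      obtain ⟨X₂, rfl⟩ := hobj X''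
      obtain ⟨φ, rfl⟩ := (𝔊).map_surjective φ'
      obtain ⟨β, rfl⟩ := (𝔊).map_surjective β'
      obtain ⟨α, rfl⟩ := (𝔊).map_surjective α'
      obtain ⟨β₂, rfl⟩ := (𝔊).map_surjective β''
      obtain ⟨α₂, rfl⟩ := (𝔊).map_surjective α''
      have h1' : β ≫ α = φ := (𝔊).map_injective (by rw [Functor.map_comp]; exact h1)
      have h2' : β₂ ≫ α₂ = φ := (𝔊).map_injective (by rw [Functor.map_comp]; exact h2)
      obtain ⟨γ, hγβ, hγα⟩ := hF.v_b_unique φ β α β₂ α₂ h1' ((hcps β).mp hβ)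
        ⟨(hiso α).mp hα.1, (hpre α).mp hα.2⟩ h2' ((hcps β₂).mp hβ') ⟨(hiso α₂).mp hα'.1, (hpre α₂).mp hα'.2⟩
      refine ⟨(𝔊).mapIso γ, ?_, ?_⟩
      · rw [Functor.mapIso_hom, ← Functor.map_comp, hγβ]
      · rw [Functor.mapIso_hom, ← Functor.map_comp, hγα]
    v_c_exists := fun A' B' φ' hφ => by
      obtain ⟨A, rfl⟩ := hobj A'
      obtain ⟨B, rfl⟩ := hobj B'
      obtain ⟨φ, rfl⟩ := (𝔊).map_surjective φ'
      obtain ⟨X, β, α, hfac, hβ, hα⟩ := hF.v_c_exists φ ((hpre φ).mp hφ)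
      exact ⟨(𝔊).obj X, (𝔊).map β, (𝔊).map α, by rw [← Functor.map_comp, hfac],
        ⟨(hiso β).mpr hβ.1, (hpre β).mpr hβ.2⟩, (hcps α).mpr hα⟩
    v_c_unique := fun A' B' X' X'' φ' β' α' β'' α'' h1 hβ hα h2 hβ' hα' => by
      obtain ⟨A, rfl⟩ := hobj A'
      obtain ⟨B, rfl⟩ := hobj B'
      obtain ⟨X, rfl⟩ := hobj X'
      obtain ⟨X₂, rfl⟩ := hobj X''
      obtain ⟨φ, rfl⟩ := (𝔊).map_surjective φ'
      obtain ⟨β, rfl⟩ := (𝔊).map_surjective β'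
      obtain ⟨α, rfl⟩ := (𝔊).map_surjective α'
      obtain ⟨β₂, rfl⟩ := (𝔊).map_surjective β''
      obtain ⟨α₂, rfl⟩ := (𝔊).map_surjective α''
      have h1' : β ≫ α = φ := (𝔊).map_injective (by rw [Functor.map_comp]; exact h1)
      have h2' : β₂ ≫ α₂ = φ := (𝔊).map_injective (by rw [Functor.map_comp]; exact h2)
      obtain ⟨γ, hγβ, hγα⟩ := hF.v_c_unique φ β α β₂ α₂ h1' ⟨(hiso β).mp hβ.1, (hpre β).mp hβ.2⟩
        ((hcps α).mp hα) h2' ⟨(hiso β₂).mp hβ'.1, (hpre β₂).mp hβ'.2⟩ ((hcps α₂).mp hα')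
      refine ⟨(𝔊).mapIso γ, ?_, ?_⟩
      · rw [Functor.mapIso_hom, ← Functor.map_comp, hγβ]
      · rw [Functor.mapIso_hom, ← Functor.map_comp, hγα]
    vi := fun A' B' φ' ψ' hφ hψ hbe hme => by
      obtain ⟨A, rfl⟩ := hobj A'
      obtain ⟨B, rfl⟩ := hobj B'
      obtain ⟨φ, rfl⟩ := (𝔊).map_surjective φ'
      obtain ⟨ψ, rfl⟩ := (𝔊).map_surjective ψ'
      have hbe' : BaseEquivalent F φ ψ := (hb φ).symm.trans ((show _ = _ from hbe).trans (hb ψ))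
      obtain ⟨α, hα, hαψ⟩ := hF.vi φ ψ ((hcps φ).mp hφ) ((hcps ψ).mp hψ) hbe'
        ((metricallyEquivalent_cdFunctor_map_iff hF τ hmt haa δ hnorm hδ φ ψ).mp hme)
      exact ⟨(𝔊).mapIso α, mapIso_mem_unitsSubgroup hF τ hmt haa δ hnorm hα,
        by rw [Functor.mapIso_hom, ← Functor.map_comp, hαψ]⟩
    vii_a := fun A' => by
      obtain ⟨A, rfl⟩ := hobj A'
      obtain ⟨B, φ, hφ⟩ := hF.vii_a A
      exact ⟨(𝔊).obj B, (𝔊).map φ, isIsotropicHull_cdFunctor_map hF τ hmt haa δ hnorm hδ hφ⟩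
    vii_b := fun A' B' φ' hA => by
      obtain ⟨A, rfl⟩ := hobj A'
      obtain ⟨B, rfl⟩ := hobj B'
      obtain ⟨φ, rfl⟩ := (𝔊).map_surjective φ'
      exact (isIsotropic_cdFunctor_obj_iff hF τ hmt haa δ hnorm hδ B).mpr
        (hF.vii_b φ ((isIsotropic_cdFunctor_obj_iff hF τ hmt haa δ hnorm hδ A).mp hA)) }

end CharacteristicSplitting

/-! ### The named statement -/

/-- **Prop. 2.5 (iii), bracket** (`Λ = ℤ`, `d ∈ ℕ_{≥1}`, `δ = powEnd Φ d`): for every characteristic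
splitting on a Frobenioid of Frobenius-normalized, metrically trivial and `Aut`-ample type, "`C(d)`,
equipped with the natural functor `C(d) → F_{d·Φ}`, is a Frobenioid" — the named statement
`CdIsFrobenioid F d`. [cite: MochizukiFrdI2008, Prop. 2.5(iii) p.49] -/
theorem cdIsFrobenioid (d : ℕ+) :
    Literature.AlgebraicGeometry.Frobenioids.PreFrobenioid.CdIsFrobenioid F d :=
  fun τ hF hnorm hmt haa =>
    CharacteristicSplitting.isFrobenioid_cd hF τ hmt haa (powEnd Φ d) hnorm
      (powEnd_app_injective hF.isPreFrobenioid d)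

end PreFrobenioid

end Literature.AlgebraicGeometry.Frobenioids
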